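import Mathlib
import Summits.CriticalPhenomena.CardyFormulaZ2.Theorems.CardySelfRefinementDefs
import Summits.CriticalPhenomena.CardyFormulaZ2.Theorems.CardySelfRefinementTrivialSectorRateStubSixArmSectorMassFactorisation
import Summits.CriticalPhenomena.CardyFormulaZ2.Theorems.CardySelfRefinementTrivialSectorRateStubSixArmSectorMassSummation
import Summits.CriticalPhenomena.CardyFormulaZ2.Theorems.CardySelfRefinementTrivialSectorRateStubPivotalMassWeights
import Summits.CriticalPhenomena.CardyFormulaZ2.Theorems.CardySelfRefinementTrivialSectorRateStubPivotalMassDictionary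
import HarnessLib

/-!
# Stub `sixArmSectorMass_kMultiple` (line `far-field-is-a-quarter-turn`, crux `TrivialSectorRate`,
stmt-CriticalPhenomena-10266): the six-arm sector mass at far-field radii in `kℕ`

Skeleton r4 of the line invokes the local engine only at radii `R ∈ kℕ` (the coin window of the
`R`-box is quarter-turn invariant iff `k ∣ R`), so the far-field radius of the block of `u` is
`R_u := k ⌊farScale u / k⌋₊` (a multiple of `k` in `(farScale u − k, farScale u]`) instead of
`⌊farScale u⌋₊`, and the far blocks are those with `R₀ ≤ farScale u / k`.  This file proves the
corresponding variant of `sixArmSectorMass_corrected`: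

* `sixArmSectorMass_kMultiple_of_boundaryRelevance` — the dyadic summation, adapted from
  `sixArmSectorMass_of_boundaryRelevance` (`…StubSixArmSectorMassSummation`): for `0 < k`, six-arm
  decay along `γ` (H6) and boundary relevance above one (HB) give
  `Σ_{u ∈ W} Six(u, k⌊farScale u / k⌋₊) ≤ C η^{ε'}` over EVERY finite set of blocks `W`, uniformly in
  `s` and small `η`; the far-field factorisation (HF) is discharged by `Six_le_real_sixArm_mul_real_Rel`.
* `sixArmSectorMass_kMultiple` — the registered stub signature (`k = 2, 3`).

Proof (as in the template, with the new radius).  Write `x_u = farScale u`, `R_u = k⌊x_u/k⌋₊`, so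
`x_u − k < R_u ≤ x_u` and `bdist u = 8ηx_u`.  Blocks with `x_u < B := max R₀ (4k)` have
`Six ≤ M(Rel u R_u) ≤ M(Rel u (4B))` and `bdist u < 2·(4B)·η`: charged to (HB) at scale `4B`.  Blocks
with `X = 2^jB ≤ x_u < 2X` have `R_u > X − k ≥ 3k`, `R_u − k > X − 2k ≥ X/2`, so by (HF) at
`R' = R_u − k` and (H6), `Six ≤ C₆ (2(k+1)/X)^{2+ε} M(Rel u (8X))`, and `bdist u < 2·(8X)·η`, so (HB)
at scale `8X` bounds the layer by `K X^{−ε/2} η^{b'}` (`b' = min(b, ε/2)`, `sector_layer_algebra`),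
a geometric series in `j`.
-/

noncomputable section

namespace Summit.CriticalPhenomena.CardyFormulaZ2.Theorems.CardySelfRefinement.FarField

open scoped Topology
open Filter Set MeasureTheory
open Literature.Probability.LatticeModels Literature.Probability.Percolation
open Literature.Probability.Percolation.QuadCrossing
open Summit.CriticalPhenomena.CardyFormulaZ2.Theses.CardySelfRefinement

/-! ## The radius `k ⌊y / k⌋₊` -/

/-- `k ⌊y/k⌋₊ ≤ y` for `0 ≤ y`, `0 < k` (cast to `ℝ`). -/
theorem cast_mul_floor_div_le {k : ℕ} (hk : 0 < k) {y : ℝ} (hy : 0 ≤ y) :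
    ((k * ⌊y / k⌋₊ : ℕ) : ℝ) ≤ y := by
  have hk' : (0 : ℝ) < k := by exact_mod_cast hk
  have h := Nat.floor_le (div_nonneg hy hk'.le)
  push_cast
  calc (k : ℝ) * (⌊y / k⌋₊ : ℝ) ≤ k * (y / k) := mul_le_mul_of_nonneg_left h hk'.le
    _ = y := mul_div_cancel₀ _ hk'.ne'

/-- `y < k ⌊y/k⌋₊ + k` for `0 < k` (cast to `ℝ`). -/
theorem lt_cast_mul_floor_div_add {k : ℕ} (hk : 0 < k) (y : ℝ) :
    y < ((k * ⌊y / k⌋₊ : ℕ) : ℝ) + k := by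
  have hk' : (0 : ℝ) < k := by exact_mod_cast hk
  have h2 := mul_lt_mul_of_pos_left (Nat.lt_floor_add_one (y / k)) hk'
  rw [mul_div_cancel₀ _ hk'.ne'] at h2
  push_cast
  linarith only [h2]

/-! ## The summation theorem at radii in `kℕ` -/

/-- **SIX-ARM SECTOR MASS AT RADII IN `kℕ` FROM (H6) + (HB)** (the `k`-multiple variant of
`sixArmSectorMass_of_boundaryRelevance`): for `0 < k`, six-arm decay along `γ` and boundary relevance
above one for `F` along `γ` (verbatim the (HB) of `weightedPivotalMass_of_factorisation`), for every
`R₀ ≥ 1` the sector terms `Six(u, k⌊farScale u / k⌋₊)` of the blocks with `R₀ ≤ farScale u / k` total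
`O(η^ε)` uniformly in `s`, small `η` and finite `U`. -/
theorem sixArmSectorMass_kMultiple_of_boundaryRelevance {k : ℕ} (hk : 0 < k)
    {γ : unitInterval → ℝ × ℝ} (h6 : SixArmDecayAlong k γ) {m : ℕ} {F : Fin m → Quad (univ : Set ℂ)}
    (hB : ∃ b C₀ η₀ : ℝ, 0 < b ∧ 0 < η₀ ∧ ∀ (s : unitInterval), ∀ η ∈ Set.Ioo (0 : ℝ) η₀, ∀ (D : ℕ), 1 ≤ D →
        ∀ U : Finset (Site 2),
          ∑ u ∈ U.filter (fun u => bdist k m F η u < 2 * D * η),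
            (M k (γ s).1 (γ s).2).real (Rel k m F η u D) ≤ C₀ * (D : ℝ) ^ 2 * min 1 (((D : ℝ) * η) ^ b))
    (R₀ : ℕ) (hR₀ : 1 ≤ R₀) :
    ∃ ε C η₁ : ℝ, 0 < ε ∧ 0 ≤ C ∧ 0 < η₁ ∧ ∀ (s : unitInterval), ∀ η ∈ Set.Ioo (0 : ℝ) η₁,
      ∀ U : Finset (Site 2),
        ∑ u ∈ U.filter (fun u => (R₀ : ℝ) ≤ farScale k m F η u / k),
          Six k m F η (γ s) u (k * ⌊farScale k m F η u / k⌋₊) ≤ C * η ^ ε := by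
  obtain ⟨ε, C₆, hε, h6⟩ := h6
  obtain ⟨b, C₀, η₀, hb, hη₀, hB⟩ := hB
  -- nonnegative majorants of the constants
  obtain ⟨C₆', hC₆'⟩ : ∃ C : ℝ, C = max C₆ 0 := ⟨_, rfl⟩
  obtain ⟨C₀', hC₀'⟩ : ∃ C : ℝ, C = max C₀ 0 := ⟨_, rfl⟩
  have hC₆'0 : 0 ≤ C₆' := hC₆' ▸ le_max_right _ _
  have hC₀'0 : 0 ≤ C₀' := hC₀' ▸ le_max_right _ _
  have hC₆le : C₆ ≤ C₆' := hC₆' ▸ le_max_left _ _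
  have hC₀le : C₀ ≤ C₀' := hC₀' ▸ le_max_left _ _
  -- the base scale `B ≥ R₀, 4k`
  obtain ⟨B, hBdef⟩ : ∃ R : ℕ, R = max R₀ (4 * k) := ⟨_, rfl⟩
  have hR₀B : R₀ ≤ B := hBdef ▸ le_max_left _ _
  have hkB : 4 * k ≤ B := hBdef ▸ le_max_right _ _
  have hB1 : 1 ≤ B := hR₀.trans hR₀B
  have hB1r : (1 : ℝ) ≤ B := by exact_mod_cast hB1
  have hBpos : (0 : ℝ) < B := by linarith
  -- exponents and the geometric ratio
  obtain ⟨b', hb'def⟩ : ∃ x : ℝ, x = min b (ε / 2) := ⟨_, rfl⟩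
  have hb'0 : 0 < b' := hb'def ▸ lt_min hb (by linarith)
  have hb'b : b' ≤ b := hb'def ▸ min_le_left _ _
  have hb'ε : b' - ε ≤ -(ε / 2) := by have := min_le_right b (ε / 2); rw [← hb'def] at this; linarith
  obtain ⟨q, hqdef⟩ : ∃ x : ℝ, x = (2 : ℝ) ^ (-(ε / 2)) := ⟨_, rfl⟩
  have hq0 : 0 ≤ q := hqdef ▸ Real.rpow_nonneg (by norm_num) _
  have hq1 : q < 1 := hqdef ▸ Real.rpow_lt_one_of_one_lt_of_neg (by norm_num) (by linarith)
  have h1q : 0 < 1 - q := by linarith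
  -- constants
  obtain ⟨a, hadef⟩ : ∃ x : ℝ, x = 2 * ((k : ℝ) + 1) := ⟨_, rfl⟩
  have ha0 : 0 ≤ a := by rw [hadef]; positivity
  obtain ⟨Ks, hKsdef⟩ : ∃ x : ℝ, x = C₀' * ((4 * B : ℕ) : ℝ) ^ 2 * ((4 * B : ℕ) : ℝ) ^ b' := ⟨_, rfl⟩
  have hKs0 : 0 ≤ Ks := by rw [hKsdef]; positivity
  obtain ⟨K₁, hK₁def⟩ : ∃ x : ℝ, x = 64 * (8 : ℝ) ^ b' * C₆' * C₀' * a ^ (2 + ε) := ⟨_, rfl⟩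
  have hK₁0 : 0 ≤ K₁ := by rw [hK₁def]; positivity
  refine ⟨b', Ks + K₁ * (1 - q)⁻¹, η₀, hb'0, by positivity, hη₀, ?_⟩
  intro s η hη U
  have hη0 : 0 < η := hη.1
  haveI := isProbabilityMeasure_M k (γ s).1 (γ s).2
  -- shorthands: far-field scale `x u` and the summand `f u`
  obtain ⟨x, hxdef⟩ : ∃ g : Site 2 → ℝ, g = farScale k m F η := ⟨_, rfl⟩
  obtain ⟨f, hfdef⟩ : ∃ g : Site 2 → ℝ, g = fun u => Six k m F η (γ s) u (k * ⌊x u / k⌋₊) := ⟨_, rfl⟩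
  have hf0 : ∀ u, 0 ≤ f u := fun u => by rw [hfdef]; exact measureReal_nonneg
  have hbd0 : ∀ u, 0 ≤ bdist k m F η u := fun u => by unfold bdist; exact Metric.infDist_nonneg
  have hx0 : ∀ u, 0 ≤ x u := fun u => by
    rw [hxdef]; unfold farScale; exact div_nonneg (hbd0 u) (by positivity)
  have hbd_eq : ∀ u, bdist k m F η u = 8 * η * x u := fun u => by
    rw [hxdef]; unfold farScale; field_simp
  -- the radius `R_u = k ⌊x u / k⌋₊` lies in `(x u - k, x u]`
  have hRle : ∀ u, ((k * ⌊x u / k⌋₊ : ℕ) : ℝ) ≤ x u := fun u => cast_mul_floor_div_le hk (hx0 u)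
  have hltR : ∀ u, x u < ((k * ⌊x u / k⌋₊ : ℕ) : ℝ) + k := fun u =>
    lt_cast_mul_floor_div_add hk (x u)
  -- (HB) at scale `D` over blocks within `2Dη`, with the majorant constant and the exponent `b'`
  have hBD : ∀ (D : ℕ), 1 ≤ D → ∀ (W : Finset (Site 2)),
      (∀ u ∈ W, bdist k m F η u < 2 * D * η) →
      ∑ u ∈ W, (M k (γ s).1 (γ s).2).real (Rel k m F η u D) ≤ C₀' * (D : ℝ) ^ 2 * ((D : ℝ) * η) ^ b' := by
    intro D hD W hW
    have hD0 : (0 : ℝ) < D := by exact_mod_cast hD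
    have hfil : W.filter (fun u => bdist k m F η u < 2 * D * η) = W := Finset.filter_true_of_mem hW
    have h := hB s η hη D hD W
    rw [hfil] at h
    have hmin0 : 0 ≤ min 1 (((D : ℝ) * η) ^ b) :=
      le_min zero_le_one (Real.rpow_nonneg (by positivity) _)
    have hmin : min 1 (((D : ℝ) * η) ^ b) ≤ ((D : ℝ) * η) ^ b' :=
      min_one_rpow_le_rpow (by positivity) hb'0.le hb'b
    calc ∑ u ∈ W, (M k (γ s).1 (γ s).2).real (Rel k m F η u D)
        ≤ C₀ * (D : ℝ) ^ 2 * min 1 (((D : ℝ) * η) ^ b) := h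
      _ ≤ C₀' * (D : ℝ) ^ 2 * min 1 (((D : ℝ) * η) ^ b) :=
          mul_le_mul_of_nonneg_right (mul_le_mul_of_nonneg_right hC₀le (by positivity)) hmin0
      _ ≤ C₀' * (D : ℝ) ^ 2 * ((D : ℝ) * η) ^ b' := mul_le_mul_of_nonneg_left hmin (by positivity)
  -- the bound holds over EVERY finite set of blocks (far-ness is not needed)
  suffices key : ∀ W : Finset (Site 2), ∑ u ∈ W, f u ≤ (Ks + K₁ * (1 - q)⁻¹) * η ^ b' by
    have h := key (U.filter (fun u => (R₀ : ℝ) ≤ farScale k m F η u / k))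
    rw [hfdef, hxdef] at h
    exact h
  intro W
  -- (1) the small blocks `x u < B`: `Six ≤ M(Rel u R_u) ≤ M(Rel u (4B))`, charged to (HB) at `4B`
  have hsmall : ∑ u ∈ W.filter (fun u => x u < B), f u ≤ Ks * η ^ b' := by
    have hD1 : 1 ≤ 4 * B := by omega
    have h1 : ∀ u ∈ W.filter (fun u => x u < B),
        f u ≤ (M k (γ s).1 (γ s).2).real (Rel k m F η u (4 * B)) := by
      intro u hu
      obtain ⟨-, hxB⟩ := Finset.mem_filter.1 hu
      have hRu : k * ⌊x u / k⌋₊ ≤ 4 * B := by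
        have h' : ((k * ⌊x u / k⌋₊ : ℕ) : ℝ) < B := (hRle u).trans_lt hxB
        have : k * ⌊x u / k⌋₊ < B := by exact_mod_cast h'
        omega
      calc f u = Six k m F η (γ s) u (k * ⌊x u / k⌋₊) := by rw [hfdef]
        _ ≤ (M k (γ s).1 (γ s).2).real (Rel k m F η u (k * ⌊x u / k⌋₊)) :=
            measureReal_mono Set.inter_subset_right (measure_ne_top _ _)
        _ ≤ (M k (γ s).1 (γ s).2).real (Rel k m F η u (4 * B)) :=
            measureReal_mono (Rel_mono k m F η u hRu) (measure_ne_top _ _)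
    have h2 : ∀ u ∈ W.filter (fun u => x u < B), bdist k m F η u < 2 * ((4 * B : ℕ) : ℝ) * η := by
      intro u hu
      obtain ⟨-, hxB⟩ := Finset.mem_filter.1 hu
      have h8 : (0 : ℝ) < 8 * η := by positivity
      have := mul_lt_mul_of_pos_left hxB h8
      rw [hbd_eq u]
      push_cast
      linarith only [this]
    calc ∑ u ∈ W.filter (fun u => x u < B), f u
        ≤ ∑ u ∈ W.filter (fun u => x u < B), (M k (γ s).1 (γ s).2).real (Rel k m F η u (4 * B)) :=
          Finset.sum_le_sum h1
      _ ≤ C₀' * ((4 * B : ℕ) : ℝ) ^ 2 * (((4 * B : ℕ) : ℝ) * η) ^ b' := hBD (4 * B) hD1 _ h2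
      _ = Ks * η ^ b' := by
          rw [Real.mul_rpow (by positivity) hη0.le, hKsdef]
          ring
  -- (2) the dyadic layers `X = 2^j B ≤ x u < 2X`
  have hlayer : ∀ j : ℕ,
      ∑ u ∈ W.filter (fun u => ((2 ^ j * B : ℕ) : ℝ) ≤ x u ∧ x u < 2 * ((2 ^ j * B : ℕ) : ℝ)), f u ≤
        K₁ * q ^ j * η ^ b' := by
    intro j
    have hBX : B ≤ 2 ^ j * B := Nat.le_mul_of_pos_left _ (pow_pos two_pos j)
    have hX1n : 1 ≤ 2 ^ j * B := hB1.trans hBX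
    have hX1 : (1 : ℝ) ≤ ((2 ^ j * B : ℕ) : ℝ) := by exact_mod_cast hX1n
    have hX0 : (0 : ℝ) < ((2 ^ j * B : ℕ) : ℝ) := by linarith only [hX1]
    have hkX : 4 * k ≤ 2 ^ j * B := hkB.trans hBX
    -- per block: (HF) at `R' = R_u - k`, (H6), and `Rel u R_u ⊆ Rel u (8X)`
    have hblock : ∀ u ∈ W.filter (fun u => ((2 ^ j * B : ℕ) : ℝ) ≤ x u ∧ x u < 2 * ((2 ^ j * B : ℕ) : ℝ)),
        f u ≤ C₆' * (a / ((2 ^ j * B : ℕ) : ℝ)) ^ (2 + ε) *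
          (M k (γ s).1 (γ s).2).real (Rel k m F η u (8 * (2 ^ j * B))) := by
      intro u hu
      obtain ⟨-, hlo, hhi⟩ := Finset.mem_filter.1 hu
      obtain ⟨Ru, hRudef⟩ : ∃ R : ℕ, R = k * ⌊x u / k⌋₊ := ⟨_, rfl⟩
      have hRux : (Ru : ℝ) ≤ x u := hRudef ▸ hRle u
      have hxRu : x u < (Ru : ℝ) + k := hRudef ▸ hltR u
      have hXRur : ((2 ^ j * B : ℕ) : ℝ) < (Ru : ℝ) + k := hlo.trans_lt hxRu
      have hXRu : 2 ^ j * B < Ru + k := by exact_mod_cast hXRur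
      have hRu2X : (Ru : ℝ) < 2 * ((2 ^ j * B : ℕ) : ℝ) := lt_of_le_of_lt hRux hhi
      have hkRu : 3 * k < Ru := by omega
      have hR'1 : k + 1 ≤ Ru - k := by omega
      have hR'2 : Ru - k + k ≤ Ru := by omega
      have hRu8X : Ru ≤ 8 * (2 ^ j * B) := by
        have h' : (Ru : ℝ) < ((2 * (2 ^ j * B) : ℕ) : ℝ) := by push_cast at hRu2X ⊢; exact hRu2X
        have h'' : Ru < 2 * (2 ^ j * B) := by exact_mod_cast h'
        omega
      -- (HF), proved: `Six_le_real_sixArm_mul_real_Rel`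
      have hFu := Six_le_real_sixArm_mul_real_Rel hk m F hη0.ne' (γ s) u hR'1 hR'2
      -- (H6) at `r = k + 1`, `R = Ru - k`
      have h6u := h6 s (ctr k u) (k + 1) (Ru - k) (by omega) hR'1
      have hcast : ((Ru - k : ℕ) : ℝ) = (Ru : ℝ) - k := by
        rw [Nat.cast_sub (by omega)]
      have hden : ((2 ^ j * B : ℕ) : ℝ) / 2 ≤ (Ru : ℝ) - k := by
        have h2 : 4 * (k : ℝ) ≤ ((2 ^ j * B : ℕ) : ℝ) := by exact_mod_cast hkX
        linarith only [hXRur, h2, hX0]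
      have hratio : (((k + 1 : ℕ) : ℝ)) / ((Ru - k : ℕ) : ℝ) ≤ a / ((2 ^ j * B : ℕ) : ℝ) := by
        rw [hcast, hadef]
        have hkk : (((k + 1 : ℕ) : ℝ)) = (k : ℝ) + 1 := by push_cast; ring
        rw [hkk]
        calc ((k : ℝ) + 1) / ((Ru : ℝ) - k)
            ≤ ((k : ℝ) + 1) / (((2 ^ j * B : ℕ) : ℝ) / 2) :=
              div_le_div_of_nonneg_left (by positivity) (by positivity) hden
          _ = 2 * ((k : ℝ) + 1) / ((2 ^ j * B : ℕ) : ℝ) := by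
              field_simp
      have hratio0 : 0 ≤ (((k + 1 : ℕ) : ℝ)) / ((Ru - k : ℕ) : ℝ) := by positivity
      have hsix : (M k (γ s).1 (γ s).2).real (sixArmThreeClustersAt (ctr k u) (k + 1) (Ru - k)) ≤
          C₆' * (a / ((2 ^ j * B : ℕ) : ℝ)) ^ (2 + ε) :=
        calc (M k (γ s).1 (γ s).2).real (sixArmThreeClustersAt (ctr k u) (k + 1) (Ru - k))
            ≤ C₆ * ((((k + 1 : ℕ) : ℝ)) / ((Ru - k : ℕ) : ℝ)) ^ (2 + ε) := h6u
          _ ≤ C₆' * ((((k + 1 : ℕ) : ℝ)) / ((Ru - k : ℕ) : ℝ)) ^ (2 + ε) :=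
              mul_le_mul_of_nonneg_right hC₆le (Real.rpow_nonneg hratio0 _)
          _ ≤ C₆' * (a / ((2 ^ j * B : ℕ) : ℝ)) ^ (2 + ε) :=
              mul_le_mul_of_nonneg_left
                (Real.rpow_le_rpow hratio0 hratio (by linarith only [hε])) hC₆'0
      have hRel : (M k (γ s).1 (γ s).2).real (Rel k m F η u Ru) ≤
          (M k (γ s).1 (γ s).2).real (Rel k m F η u (8 * (2 ^ j * B))) :=
        measureReal_mono (Rel_mono k m F η u hRu8X) (measure_ne_top _ _)
      calc f u = Six k m F η (γ s) u Ru := by rw [hfdef, hRudef]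
        _ ≤ (M k (γ s).1 (γ s).2).real (sixArmThreeClustersAt (ctr k u) (k + 1) (Ru - k)) *
              (M k (γ s).1 (γ s).2).real (Rel k m F η u Ru) := hFu
        _ ≤ C₆' * (a / ((2 ^ j * B : ℕ) : ℝ)) ^ (2 + ε) *
              (M k (γ s).1 (γ s).2).real (Rel k m F η u (8 * (2 ^ j * B))) :=
            mul_le_mul hsix hRel measureReal_nonneg (by positivity)
    -- sum over the layer: (HB) at scale `8X`, the layer algebra and the geometric factor
    have hnear : ∀ u ∈ W.filter (fun u => ((2 ^ j * B : ℕ) : ℝ) ≤ x u ∧ x u < 2 * ((2 ^ j * B : ℕ) : ℝ)),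
        bdist k m F η u < 2 * ((8 * (2 ^ j * B) : ℕ) : ℝ) * η := by
      intro u hu
      obtain ⟨-, -, hhi⟩ := Finset.mem_filter.1 hu
      have h8 : (0 : ℝ) < 8 * η := by positivity
      have := mul_lt_mul_of_pos_left hhi h8
      rw [hbd_eq u]
      push_cast at this ⊢
      linarith only [this]
    have hD1 : 1 ≤ 8 * (2 ^ j * B) := by omega
    have hsum := hBD (8 * (2 ^ j * B)) hD1 _ hnear
    have hcast8 : ((8 * (2 ^ j * B) : ℕ) : ℝ) = 8 * ((2 ^ j * B : ℕ) : ℝ) := by push_cast; ring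
    rw [hcast8] at hsum
    have hgeom : ((2 ^ j * B : ℕ) : ℝ) ^ (-(ε / 2)) ≤ q ^ j := by
      rw [hqdef]
      exact rpow_neg_le_geom hε hB1 j
    have hpref : 0 ≤ C₆' * (a / ((2 ^ j * B : ℕ) : ℝ)) ^ (2 + ε) := by positivity
    calc ∑ u ∈ W.filter (fun u => ((2 ^ j * B : ℕ) : ℝ) ≤ x u ∧ x u < 2 * ((2 ^ j * B : ℕ) : ℝ)), f u
        ≤ ∑ u ∈ W.filter (fun u => ((2 ^ j * B : ℕ) : ℝ) ≤ x u ∧ x u < 2 * ((2 ^ j * B : ℕ) : ℝ)),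
            C₆' * (a / ((2 ^ j * B : ℕ) : ℝ)) ^ (2 + ε) *
              (M k (γ s).1 (γ s).2).real (Rel k m F η u (8 * (2 ^ j * B))) :=
          Finset.sum_le_sum hblock
      _ = C₆' * (a / ((2 ^ j * B : ℕ) : ℝ)) ^ (2 + ε) *
            ∑ u ∈ W.filter (fun u => ((2 ^ j * B : ℕ) : ℝ) ≤ x u ∧ x u < 2 * ((2 ^ j * B : ℕ) : ℝ)),
              (M k (γ s).1 (γ s).2).real (Rel k m F η u (8 * (2 ^ j * B))) := by
          rw [Finset.mul_sum]
      _ ≤ C₆' * (a / ((2 ^ j * B : ℕ) : ℝ)) ^ (2 + ε) *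
            (C₀' * (8 * ((2 ^ j * B : ℕ) : ℝ)) ^ 2 * (8 * ((2 ^ j * B : ℕ) : ℝ) * η) ^ b') :=
          mul_le_mul_of_nonneg_left hsum hpref
      _ ≤ (64 * (8 : ℝ) ^ b' * C₆' * C₀' * a ^ (2 + ε)) * ((2 ^ j * B : ℕ) : ℝ) ^ (-(ε / 2)) * η ^ b' :=
          sector_layer_algebra hX1 hη0 ha0 hC₆'0 hC₀'0 hb'ε
      _ = K₁ * ((2 ^ j * B : ℕ) : ℝ) ^ (-(ε / 2)) * η ^ b' := by rw [hK₁def]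
      _ ≤ K₁ * q ^ j * η ^ b' :=
          mul_le_mul_of_nonneg_right (mul_le_mul_of_nonneg_left hgeom hK₁0) (by positivity)
  -- (3) every block is small or lies in a layer `j < J`
  obtain ⟨T, hTdef⟩ : ∃ y : ℝ, y = (∑ u ∈ W, x u) + 1 := ⟨_, rfl⟩
  obtain ⟨J, hJ⟩ := pow_unbounded_of_one_lt T (one_lt_two : (1 : ℝ) < 2)
  have hcover : ∀ u ∈ W, f u ≤ (if x u < B then f u else 0) +
      ∑ j ∈ Finset.range J,
        (if ((2 ^ j * B : ℕ) : ℝ) ≤ x u ∧ x u < 2 * ((2 ^ j * B : ℕ) : ℝ) then f u else 0) := by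
    intro u hu
    have hterm0 : ∀ j, 0 ≤ (if ((2 ^ j * B : ℕ) : ℝ) ≤ x u ∧ x u < 2 * ((2 ^ j * B : ℕ) : ℝ)
        then f u else 0) := fun j => by
      split_ifs
      · exact hf0 u
      · exact le_rfl
    have hsum0 : 0 ≤ ∑ j ∈ Finset.range J,
        (if ((2 ^ j * B : ℕ) : ℝ) ≤ x u ∧ x u < 2 * ((2 ^ j * B : ℕ) : ℝ) then f u else 0) :=
      Finset.sum_nonneg fun j _ => hterm0 j
    by_cases hc : x u < B
    · rw [if_pos hc]
      linarith only [hsum0]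
    · rw [if_neg hc, zero_add]
      have hBx : (B : ℝ) ≤ x u := le_of_not_gt hc
      obtain ⟨y, hydef⟩ : ∃ z : ℝ, z = x u / B := ⟨_, rfl⟩
      have hxy : x u = y * B := by rw [hydef, div_mul_cancel₀ _ hBpos.ne']
      have hy1 : 1 ≤ y := by rw [hydef, le_div_iff₀ hBpos]; linarith only [hBx]
      obtain ⟨n, hn1, hn2⟩ := exists_nat_pow_near hy1 one_lt_two
      have hyT : y < T := by
        have h1 : x u ≤ ∑ v ∈ W, x v := Finset.single_le_sum (fun v _ => hx0 v) hu
        have h2 : y ≤ x u := by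
          rw [hydef, div_le_iff₀ hBpos]
          have := mul_le_mul_of_nonneg_left hB1r (hx0 u)
          linarith only [this]
        rw [hTdef]
        linarith only [h1, h2]
      have hnJ : n < J := by
        have : (2 : ℝ) ^ n < 2 ^ J := lt_of_le_of_lt hn1 (hyT.trans hJ)
        exact (pow_lt_pow_iff_right₀ one_lt_two).1 this
      have hlayer_n : ((2 ^ n * B : ℕ) : ℝ) ≤ x u ∧ x u < 2 * ((2 ^ n * B : ℕ) : ℝ) := by
        have hc2 : ((2 ^ n * B : ℕ) : ℝ) = 2 ^ n * B := by push_cast; ring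
        rw [hxy, hc2]
        constructor
        · exact mul_le_mul_of_nonneg_right hn1 hBpos.le
        · calc y * (B : ℝ) < 2 ^ (n + 1) * B := mul_lt_mul_of_pos_right hn2 hBpos
            _ = 2 * (2 ^ n * B) := by rw [pow_succ]; ring
      calc f u = (if ((2 ^ n * B : ℕ) : ℝ) ≤ x u ∧ x u < 2 * ((2 ^ n * B : ℕ) : ℝ) then f u else 0) := by
            rw [if_pos hlayer_n]
        _ ≤ ∑ j ∈ Finset.range J,
            (if ((2 ^ j * B : ℕ) : ℝ) ≤ x u ∧ x u < 2 * ((2 ^ j * B : ℕ) : ℝ) then f u else 0) :=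
          Finset.single_le_sum (f := fun j =>
              (if ((2 ^ j * B : ℕ) : ℝ) ≤ x u ∧ x u < 2 * ((2 ^ j * B : ℕ) : ℝ) then f u else 0))
            (fun j _ => hterm0 j) (Finset.mem_range.2 hnJ)
  -- (4) assemble
  have hgeomsum : ∑ j ∈ Finset.range J, q ^ j ≤ (1 - q)⁻¹ :=
    sum_le_hasSum (Finset.range J) (fun j _ => pow_nonneg hq0 j) (hasSum_geometric_of_lt_one hq0 hq1)
  have hηb : 0 ≤ η ^ b' := Real.rpow_nonneg hη0.le _
  calc ∑ u ∈ W, f u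
      ≤ ∑ u ∈ W, ((if x u < B then f u else 0) +
          ∑ j ∈ Finset.range J,
            (if ((2 ^ j * B : ℕ) : ℝ) ≤ x u ∧ x u < 2 * ((2 ^ j * B : ℕ) : ℝ) then f u else 0)) :=
        Finset.sum_le_sum hcover
    _ = ∑ u ∈ W.filter (fun u => x u < B), f u +
          ∑ j ∈ Finset.range J,
            ∑ u ∈ W.filter (fun u => ((2 ^ j * B : ℕ) : ℝ) ≤ x u ∧ x u < 2 * ((2 ^ j * B : ℕ) : ℝ)),
              f u := by
        rw [Finset.sum_add_distrib, Finset.sum_comm, Finset.sum_filter]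
        congr 1
        exact Finset.sum_congr rfl fun j _ => (Finset.sum_filter _ _).symm
    _ ≤ Ks * η ^ b' + ∑ j ∈ Finset.range J, K₁ * q ^ j * η ^ b' :=
        add_le_add hsmall (Finset.sum_le_sum fun j _ => hlayer j)
    _ = Ks * η ^ b' + K₁ * η ^ b' * ∑ j ∈ Finset.range J, q ^ j := by
        rw [Finset.mul_sum]
        congr 1
        exact Finset.sum_congr rfl fun j _ => by ring
    _ ≤ Ks * η ^ b' + K₁ * η ^ b' * (1 - q)⁻¹ :=
        add_le_add_right (mul_le_mul_of_nonneg_left hgeomsum (mul_nonneg hK₁0 hηb)) _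
    _ = (Ks + K₁ * (1 - q)⁻¹) * η ^ b' := by ring

/-! ## The registered stub -/

/-- **Stub `sixArmSectorMass_kMultiple`** (registered helper of the crux `TrivialSectorRate`, line
`far-field-is-a-quarter-turn`, skeleton r4): along a path with six-arm decay (`k = 2, 3`), for every
quad family satisfying boundary relevance above one along the path (hypothesis (HB), verbatim that
of `sixArmSectorMass_corrected`) and every `R₀ ≥ 1`, the six-arm sector terms of the far blocks
`R₀ ≤ farScale u / k`, each at its own far-field radius `k ⌊farScale u / k⌋₊ ∈ kℕ`, total `O(η^ε)`
uniformly in `s`, small `η` and finite `U`.  (`PathOK` is not used.) -/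
theorem sixArmSectorMass_kMultiple :
    ∀ k : ℕ, k = 2 ∨ k = 3 → ∀ γ : unitInterval → ℝ × ℝ, PathOK k γ → SixArmDecayAlong k γ →
      ∀ (m : ℕ) (F : Fin m → Quad (univ : Set ℂ)),
        (∃ b C₀ η₀ : ℝ, 0 < b ∧ 0 < η₀ ∧ ∀ (s : unitInterval), ∀ η ∈ Set.Ioo (0 : ℝ) η₀, ∀ (D : ℕ), 1 ≤ D →
          ∀ U : Finset (Site 2),
            ∑ u ∈ U.filter (fun u => bdist k m F η u < 2 * D * η),
              (M k (γ s).1 (γ s).2).real (Rel k m F η u D) ≤ C₀ * (D : ℝ) ^ 2 * min 1 (((D : ℝ) * η) ^ b)) →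
        ∀ (R₀ : ℕ), 1 ≤ R₀ →
          ∃ ε C η₁ : ℝ, 0 < ε ∧ 0 ≤ C ∧ 0 < η₁ ∧ ∀ (s : unitInterval), ∀ η ∈ Set.Ioo (0 : ℝ) η₁,
            ∀ U : Finset (Site 2),
              ∑ u ∈ U.filter (fun u => (R₀ : ℝ) ≤ farScale k m F η u / k),
                Six k m F η (γ s) u (k * ⌊farScale k m F η u / k⌋₊) ≤ C * η ^ ε := by
  intro k hk γ _hγ h6 m F hB R₀ hR₀
  have hk0 : 0 < k := by rcases hk with rfl | rfl <;> norm_num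
  exact sixArmSectorMass_kMultiple_of_boundaryRelevance hk0 h6 hB R₀ hR₀

end Summit.CriticalPhenomena.CardyFormulaZ2.Theorems.CardySelfRefinement.FarField

end
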